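import Mathlib
import Summits.KontsevichZagierPeriods.Zeta5Search.LaiDecayUniform
import Summits.KontsevichZagierPeriods.Zeta5Search.LaiDecayTail
import Summits.KontsevichZagierPeriods.Zeta5Search.LaiDecayMax
import HarnessLib

/-!
# ζ(5) search — the decay inputs of Lai's box series ASSEMBLED: `LaiDecayInputs` at the κ₃ ladder point
# (fam-indep, κ₃ ladder, gen 5)

HONEST FRAMING: systematic search; no irrationality claim unless certified.

OUR work (Summit side; cell `pub-zeta5`, family `indep`, planner seat gen 5, STAGED for the lane). This file puts the
pieces of the decay certificate together:

* **`laiDecayInputsOf`** — for ANY box parameters with `2 ≤ J`, `J` even, `2δ_j < M`, `2r < Σ_j(M − 2δ_j)`, the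
  degree condition of `laiBox_hasSum_oddZeta`, and a maximiser `x₀ > r` of the profile `f` on `(r, ∞)`, an
  inhabitant of `LaiDecayInputs J r M δ (laiC J r M · δ)`: `nonneg`/`zero` (`LaiDecayStirling`), `upper`/`lower`/
  `summable` with `C := laiStirC J r` (`LaiDecayUniform`), `K`/`tail` (`LaiDecayTail`); hence
  **`laiBox_rootTest`**: `|C_n Σ_k R_n(k)|^{1/n} → exp(f(x₀)) = exp(max_{x>r} f)`.
* **`kappa3_delta_facts`** — the arithmetic side conditions at `(74, 2180, 444, delta74)` from list membership
  (`δ_j ≤ 119`), no evaluation of the 74-term sums needed.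
* **`kappa3DecayInputs`** — the instance at the κ₃ ladder point for every `δ : Fin 74 → ℕ` listing the tree's
  `delta74`, with `x₀ := 2180 + X₀` from `kappa3_profile_isMax` (`LaiDecayMax`, tree `domCheck74`); and
  **`kappa3_decay`** = EXACTLY the `decay` field of `LaiBoxInputs 74 2180 444 δ 36` with `C := laiC 74 2180 444 · δ`
  and `α := (kappa3DecayInputs δ hδ).alpha = −max_{x > 2180} f(x)` (an exact real; its numerical enclosure against
  Lai's `α̃ = 38725.88…` is a SEPARATE certificate, needed only for the numeric fields `decay_pos`/`margin`).

So the 'decay' input of the κ₃ certificate skeleton is now UNCONDITIONAL modulo filing of the staged chain.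
MANUSCRIPT-LEVEL CANDIDATE context only ('κ₃ ≤ 73'): no rate value, margin or dimension statement is made here.

References: [Lai2024BallRivoal] L. Lai, arXiv:2407.14236, (5.4)–(5.5), §13; families/indep/DECAY-L1.md §2.
-/

open Finset Filter Topology

namespace Summit.KontsevichZagierPeriods.Zeta5Search

open LaiBoxUnimodal (delta74)

noncomputable section

variable {J r M : ℕ} {δ : Fin J → ℕ}

/-! ### Generic assembly -/

/-- **Decay inputs from arithmetic + a maximiser.** All analytic fields of `LaiDecayInputs J r M δ (laiC J r M · δ)`
are theorems (`LaiDecayStirling`, `LaiDecayUniform`, `LaiDecayTail`); only the maximiser `x₀` of the profile is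
supplied (from a kernel unimodality certificate, `LaiDecayMax`). [this file] -/
def laiDecayInputsOf (hJ2 : 2 ≤ J) (hJe : Even J) (hδ : ∀ j, 2 * δ j < M) (hd : 2 * r < ∑ j, (M - 2 * δ j))
    (hdeg : ∀ n : ℕ, 1 + 2 * (r * n) + (∑ j, 2 * (δ j * n)) + 2 ≤ J * (M * n + 1)) {x₀ : ℝ} (hx₀ : (r : ℝ) < x₀)
    (hmax : ∀ x : ℝ, (r : ℝ) < x → laiProfile J r M δ x ≤ laiProfile J r M δ x₀) :
    LaiDecayInputs J r M δ (fun n => laiC J r M n δ) where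
  x₀ := x₀
  r_lt_x₀ := hx₀
  isMax := hmax
  nonneg := fun n _ν hν => laiTermR_laiC_nonneg J r M n δ hν
  zero := fun n _ν h1 h2 => laiTermR_laiC_zero J r M n δ h1 h2
  summable := laiTermR_laiC_summable hJe (by omega) (fun j => (hδ j).le) hdeg
  C := laiStirC J r
  C_nonneg := laiStirC_nonneg J r
  upper := laiTermR_laiC_upper hδ
  lower := laiTermR_laiC_lower hδ
  K := (laiTermR_laiC_tail hJ2 hδ hd (laiProfile J r M δ x₀)).choose
  tail := (laiTermR_laiC_tail hJ2 hδ hd (laiProfile J r M δ x₀)).choose_spec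

/-- **Root test for Lai's box series.** Under the hypotheses of `laiDecayInputsOf`:
`|C_n · Σ_k R_n(k+1)|^{1/n} → exp(f(x₀))`, `f(x₀) = max_{x > r} f`. [this file; DECAY-L1.md Prop. 2.4] -/
theorem laiBox_rootTest (hJ2 : 2 ≤ J) (hJe : Even J) (hδ : ∀ j, 2 * δ j < M) (hd : 2 * r < ∑ j, (M - 2 * δ j))
    (hdeg : ∀ n : ℕ, 1 + 2 * (r * n) + (∑ j, 2 * (δ j * n)) + 2 ≤ J * (M * n + 1)) {x₀ : ℝ} (hx₀ : (r : ℝ) < x₀)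
    (hmax : ∀ x : ℝ, (r : ℝ) < x → laiProfile J r M δ x ≤ laiProfile J r M δ x₀) :
    Tendsto (fun n : ℕ =>
      |((laiC J r M n δ : ℚ) : ℝ) * ∑' k : ℕ, ((laiCore J r M n δ ((k : ℚ) + 1) : ℚ) : ℝ)| ^ ((1 : ℝ) / n))
      atTop (𝓝 (Real.exp (laiProfile J r M δ x₀))) := by
  have h := (laiDecayInputsOf hJ2 hJe hδ hd hdeg hx₀ hmax).decay
  rwa [LaiDecayInputs.alpha, neg_neg] at h

/-! ### The κ₃ ladder point `(74, 2180, 444, delta74)` -/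

/-- The arithmetic side conditions at the ladder point, from `δ_j ∈ delta74 ⇒ δ_j ≤ 119`:
`2δ_j < 444`, `2·2180 < Σ_j (444 − 2δ_j)`, and the degree condition of `laiBox_hasSum_oddZeta`. [this file] -/
theorem kappa3_delta_facts (δ : Fin 74 → ℕ) (hδ : List.ofFn δ = delta74) :
    (∀ j, 2 * δ j < 444) ∧ 2 * 2180 < ∑ j, (444 - 2 * δ j) ∧
      ∀ n : ℕ, 1 + 2 * (2180 * n) + (∑ j, 2 * (δ j * n)) + 2 ≤ 74 * (444 * n + 1) := by
  have hmem : ∀ j, δ j ∈ delta74 := fun j => hδ ▸ List.mem_ofFn.2 ⟨j, rfl⟩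
  have hall : ∀ d ∈ delta74, d ≤ 119 := by decide
  have h119 : ∀ j, δ j ≤ 119 := fun j => hall _ (hmem j)
  refine ⟨fun j => by have := h119 j; omega, ?_, fun n => ?_⟩
  · have h := Finset.card_nsmul_le_sum (univ : Finset (Fin 74)) (fun j => 444 - 2 * δ j) 206
      (fun j _ => by have := h119 j; omega)
    simp only [card_univ, Fintype.card_fin, smul_eq_mul] at h
    omega
  · have h := Finset.sum_le_card_nsmul (univ : Finset (Fin 74)) (fun j => 2 * (δ j * n)) (238 * n)
      (fun j _ => by have := Nat.mul_le_mul_right n (h119 j); omega)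
    simp only [card_univ, Fintype.card_fin, smul_eq_mul] at h
    omega

/-- **κ₃ LADDER POINT — the decay inputs, assembled.** For every `δ : Fin 74 → ℕ` listing the tree's `delta74`:
an inhabitant of `LaiDecayInputs 74 2180 444 δ (laiC 74 2180 444 · δ)` with `x₀ := 2180 + X₀`
(`kappa3_profile_isMax`), `C := laiStirC 74 2180`, and `K` from `laiTermR_laiC_tail`. [this file] -/
def kappa3DecayInputs (δ : Fin 74 → ℕ) (hδ : List.ofFn δ = delta74) :
    LaiDecayInputs 74 2180 444 δ (fun n => laiC 74 2180 444 n δ) :=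
  laiDecayInputsOf (by norm_num) (by decide) (kappa3_delta_facts δ hδ).1 (kappa3_delta_facts δ hδ).2.1
    (kappa3_delta_facts δ hδ).2.2 (x₀ := 2180 + (kappa3_profile_isMax δ hδ).choose)
    (by have := (kappa3_profile_isMax δ hδ).choose_spec.1; push_cast; linarith)
    (fun x hx => (kappa3_profile_isMax δ hδ).choose_spec.2.2 x (by exact_mod_cast hx))

/-- **κ₃ LADDER POINT — FIELD `decay` of `LaiBoxInputs 74 2180 444 δ 36`** with `C := laiC 74 2180 444 · δ` and
`α := (kappa3DecayInputs δ hδ).alpha` (`= −max_{x>2180} f`, an exact real). [this file] -/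
theorem kappa3_decay (δ : Fin 74 → ℕ) (hδ : List.ofFn δ = delta74) :
    Tendsto (fun n : ℕ =>
      |((laiC 74 2180 444 n δ : ℚ) : ℝ) * ∑' k : ℕ, ((laiCore 74 2180 444 n δ ((k : ℚ) + 1) : ℚ) : ℝ)| ^ ((1 : ℝ) / n))
      atTop (𝓝 (Real.exp (-(kappa3DecayInputs δ hδ).alpha))) :=
  (kappa3DecayInputs δ hδ).decay

/-- **κ₃ LADDER POINT — root test, human-readable form**: there is `x₀ > 2180` maximising the profile on `(2180, ∞)`
with `|C_n Σ_k R_n(k+1)|^{1/n} → exp(f(x₀))`; numerically `−f(x₀) = α̃ ≈ 38725.88` (NOT certified here). [this file] -/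
theorem kappa3_rootTest (δ : Fin 74 → ℕ) (hδ : List.ofFn δ = delta74) :
    ∃ x₀ : ℝ, 2180 < x₀ ∧ (∀ x : ℝ, 2180 < x → laiProfile 74 2180 444 δ x ≤ laiProfile 74 2180 444 δ x₀) ∧
      Tendsto (fun n : ℕ =>
        |((laiC 74 2180 444 n δ : ℚ) : ℝ) * ∑' k : ℕ, ((laiCore 74 2180 444 n δ ((k : ℚ) + 1) : ℚ) : ℝ)| ^ ((1 : ℝ) / n))
        atTop (𝓝 (Real.exp (laiProfile 74 2180 444 δ x₀))) := by
  refine ⟨(kappa3DecayInputs δ hδ).x₀, ?_, fun x hx => (kappa3DecayInputs δ hδ).isMax x (by exact_mod_cast hx), ?_⟩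
  · have := (kappa3DecayInputs δ hδ).r_lt_x₀; exact_mod_cast this
  · have h := (kappa3DecayInputs δ hδ).decay
    rwa [LaiDecayInputs.alpha, neg_neg] at h

end

end Summit.KontsevichZagierPeriods.Zeta5Search
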